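import Summits.Ventures.QEC.Census.CertCheckBZAutSem
import Summits.Ventures.QEC.Census.BB.BB144.BZAut4Data
import Summits.Ventures.QEC.Census.BB.BB144.BZAut4CoverTabZ
import Summits.Ventures.QEC.Theorems.BB144DistanceCertificateLowerZ
import Literature.InformationTheory.QuantumCodes.HypergraphProductKernels
import HarnessLib

/-!
# `[[144,12,12]]` KERNEL-std programme — `LowerZ4`: the lower bound from the FOUR representative blocks of the
# orbit-cover certificate `27af9174…`, LANE-AGNOSTIC (director-qec g2 R15/R16 (e))

The 4-block `bz_aut` data `BB144.bzAut4Data` (qec-search-10 g2, `Census/BB/BB144/BZAut4Data.lean`; same rank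
certificates and logical bases as `bzData`, parity witness, blocks `bzAut4BlockZ0…3`) covers every nonzero label up to
the 72 translations of `ℤ₁₂ × ℤ₆` (qec-type-12, `coverAutTabOK_of_aut4`, `decide +kernel`). This file proves, with
standard axioms only,

  `lowerZ4_of_blockBounds : (∀ b < 4, BLOCK BOUND b) → ∀ w, H^X w = 0 → w ∉ rowspace H^Z → 11 < |w|`

where `BLOCK BOUND b` is the SEMANTIC statement «every non-trivial flat `Z`-logical whose label `LX · z` lies in
`span W_b` has weight `> 10`» (parity lifts `> 10` to `> 11`). Either lane discharges the four block bounds: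
α′ (BZ enumeration with the fast leaf: `cert.bzZBlock bzAut4Data b = true` through the adapter `blockBound4_of_bzZBlock`
below) or β (meet-in-the-middle, qec-search-9's `CertCheckBZMitm` soundness, which concludes the semantic bound
directly). `twelve_le_flat_of_blockBounds4` restates the result on `BB.bb144.HXFlat/HZFlat`; the KERNEL-std closer is
then `BB.bb144.zLowerBound_of_flat rfl rfl (twelve_le_flat_of_blockBounds4 …)` + `closes`.
Ingredients as in `Theorems/BB144DistanceCertificateLowerZ.lean` (qec-type-10): `bzAut_lower_sound_sem`, the 72
translation transports (type-07 `BB.translateFlat`, type-12 `zLogical_comp_equiv_symm_of_rowMap` /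
`label_comp_equiv_symm`), `exists_coeffs_of_ker` (L1), index identity `HX_eq_flat`/`HZ_eq_flat`.
-/

namespace Summit.Ventures.QEC.Census.BB144

open Matrix Literature.InformationTheory.QuantumCodes Literature.InformationTheory.QuantumCodes.BB
  Summit.Ventures.QEC.BB

/-! ## Structural checks of the 4-block data (KERNEL) -/

/-- Core structural check of the `Z` side of `bzAut4Data` (rank certificates, pairing, `144 = 66 + 66 + 12`, parity
witness). -/
theorem core4_ok : bzCoreOK cert.n cert.HX cert.HZ bzAut4Data.rcX bzAut4Data.rcZ bzAut4Data.LZ bzAut4Data.LX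
    bzAut4Data.sideZ.evenWitness = true := by
  decide +kernel

/-- The pairing check of `bzAut4Data`'s logical bases. -/
theorem logZ4_ok : logOK cert.n cert.HX cert.HZ bzAut4Data.LZ bzAut4Data.LX = true := by
  decide +kernel

/-- Every matrix of every block of `bzAut4Data` has `kb = |G_b|` rows (needed by the α′ adapter only). -/
theorem len4_ok : cert.bzZLen bzAut4Data = true := by
  decide +kernel

/-- **The label cover of the four blocks under the 72 translations, KERNEL** (type-12's tabulated check through
`coverAutTabOK_of_aut4`; the cover-bitmap side condition by `decide +kernel`). -/
theorem cover4_ok : coverAutTabOK 12 6 bzAut4Data.LX bzAut4Data.LZ allTranslations bzAut4Data.sideZ.blocks = true :=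
  coverAutTabOK_of_aut4 rfl rfl (by decide +kernel)

/-! ## Assembly -/

/-- The dual (label) matrix `LX` of `bzAut4Data` over the flat qubits. -/
abbrev LXmat4 : Matrix (Fin bzAut4Data.LZ.length) (Fin cert.n) (ZMod 2) :=
  ldMat cert.n bzAut4Data.LZ bzAut4Data.LX

/-- The logical matrix `LZ` of `bzAut4Data` (rows `logVec`). -/
abbrev LZmat4 : Matrix (Fin bzAut4Data.LZ.length) (Fin cert.n) (ZMod 2) := fun i => logVec cert.n bzAut4Data.LZ i

/-- The pairing in matrix form: `LX · LZᵀ = 1`. -/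
theorem LX4_mul_LZ4_transpose : LXmat4 * LZmat4ᵀ = 1 := by
  ext j i
  rw [Matrix.mul_apply', Matrix.one_apply]
  change ldMat cert.n bzAut4Data.LZ bzAut4Data.LX j ⬝ᵥ logVec cert.n bzAut4Data.LZ i = _
  rw [ldMat, dual_dotProduct_logVec logZ4_ok i j]
  by_cases h : i = j
  · subst h; simp
  · rw [if_neg h, if_neg (fun e => h e.symm)]

/-- **`LowerZ4`, lane-agnostic**: if each of the four representative blocks satisfies its SEMANTIC bound (every
non-trivial flat `Z`-logical with label in `span W_b` has weight `> 10`), then every non-trivial flat `Z`-logical of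
the certificate's code has weight `> 11`. Standard axioms. -/
theorem lowerZ4_of_blockBounds
    (hblock : ∀ (b : Fin bzAut4Data.sideZ.blocks.length) (z : Fin cert.n → ZMod 2),
      rowMatrix cert.n cert.HX *ᵥ z = 0 → z ∉ rowSpace (rowMatrix cert.n cert.HZ) →
      ldMat cert.n bzAut4Data.LZ bzAut4Data.LX *ᵥ z ∈ Submodule.span (ZMod 2)
        (Set.range fun l : Fin (bzAut4Data.sideZ.blocks[b]).W.length =>
          ofBits bzAut4Data.LZ.length (bzAut4Data.sideZ.blocks[b]).W[l]) →
      10 < hammingNorm z)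
    (w : Fin cert.n → ZMod 2) (hw : rowMatrix cert.n cert.HX *ᵥ w = 0)
    (hw' : w ∉ rowSpace (rowMatrix cert.n cert.HZ)) : 11 < hammingNorm w := by
  -- structural facts unpacked once
  have hcore := core4_ok
  simp only [bzCoreOK, Bool.and_eq_true, beq_iff_eq] at hcore
  obtain ⟨⟨⟨⟨hY, hS⟩, hL⟩, hdim⟩, -⟩ := hcore
  -- the label-action ingredients
  have hLX : ∀ a, flatCode.HZ *ᵥ LXmat4 a = 0 := fun a => mulVec_dual_eq_zero hL a
  have hexp : ∀ z, flatCode.HX *ᵥ z = 0 → z - (LXmat4 *ᵥ z) ᵥ* LZmat4 ∈ flatCode.rowSpZ := fun z hz =>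
    flatCode.sub_label_vecMul_mem_rowSpZ hLX LX4_mul_LZ4_transpose (exists_coeffs_of_ker comm_flat hY hS hL hdim hz)
  refine bzAut_lower_sound_sem (s := bzAut4Data.sideZ) (wmax := 11) comm_flat core4_ok
    (fun b z hz hz' hlab => ?_)
    (α := {t : Mono 12 6 // (((t.1 : Fin 12) : ℕ), ((t.2 : Fin 6) : ℕ)) ∈ allTranslations})
    (fun a z => z ∘ sigmaInv a.1)
    (fun a => LXmat4 * (LZmat4.submatrix id (sigmaInv a.1))ᵀ)
    (fun a z hz hz' => ?_) (fun lam hlam => ?_) w hw hw'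
  · -- the semantic block bound, parity-adjusted threshold `wEff 11 (some _) = 10`
    exact hblock b z hz hz' hlab
  · -- transport by the translation `a.1`
    have hXsub : flatCode.HX.submatrix (BB.checkTranslateFlat a.1) (BB.translateFlat a.1) = flatCode.HX := by
      have h := BB.HXFlat_submatrix_translateFlat BB.bb144 a.1
      rw [← HX_eq_flat] at h
      exact h
    have hZsub : flatCode.HZ.submatrix (BB.checkTranslateFlat a.1) (BB.translateFlat a.1) = flatCode.HZ := by
      have h := BB.HZFlat_submatrix_translateFlat BB.bb144 a.1
      rw [← HZ_eq_flat] at h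
      exact h
    obtain ⟨h1, h2⟩ := flatCode.zLogical_comp_equiv_symm_of_rowMap hXsub hZsub ⟨hz, hz'⟩
    exact ⟨h1, h2, hammingNorm_comp_equiv z (BB.translateFlat a.1 : Fin cert.n ≃ Fin cert.n),
      flatCode.label_comp_equiv_symm hLX hexp hZsub hz⟩
  · -- cover by translates (KERNEL table)
    rcases coverAutTabOK_sound (ℓ := 12) (m := 6) cover4_ok
        (P := fun μ => ∃ b : Fin bzAut4Data.sideZ.blocks.length, μ ∈ Submodule.span (ZMod 2)
          (Set.range fun l : Fin (bzAut4Data.sideZ.blocks[b]).W.length =>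
            ofBits bzAut4Data.LZ.length (bzAut4Data.sideZ.blocks[b]).W[l]))
        (fun v hv => testBit_coverMask_imp_exists_span _ _ hv)
        (Ld' := LXmat4) (L' := LZmat4) (fun i => rfl)
        (fun j => by
          change ofBits cert.n bzAut4Data.LZ[j] = ofBits cert.n (bzAut4Data.LZ.getD j 0)
          rw [List.getD_eq_getElem?_getD, List.getElem?_eq_getElem j.2, Option.getD_some]
          rfl)
        lam hlam with hP | ⟨t, ht, hPt⟩
    · exact Or.inl hP
    · obtain ⟨b, hb⟩ := hPt
      exact Or.inr ⟨⟨t, ht⟩, b, hb⟩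

/-- **`LowerZ4` on the typed code's flat matrices** (`BB.bb144.HXFlat/HZFlat`, the shape `zLowerBound_of_flat rfl rfl`
and type-12's `bb144_d_eq_of_forall_lt_flat` consume): four semantic block bounds ⇒ every non-trivial flat
`Z`-logical has weight `≥ 12`. Standard axioms. -/
theorem twelve_le_flat_of_blockBounds4
    (hblock : ∀ (b : Fin bzAut4Data.sideZ.blocks.length) (z : Fin cert.n → ZMod 2),
      rowMatrix cert.n cert.HX *ᵥ z = 0 → z ∉ rowSpace (rowMatrix cert.n cert.HZ) →
      ldMat cert.n bzAut4Data.LZ bzAut4Data.LX *ᵥ z ∈ Submodule.span (ZMod 2)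
        (Set.range fun l : Fin (bzAut4Data.sideZ.blocks[b]).W.length =>
          ofBits bzAut4Data.LZ.length (bzAut4Data.sideZ.blocks[b]).W[l]) →
      10 < hammingNorm z)
    (w : Fin (12 * 6 + 12 * 6) → ZMod 2) (hw : BB.bb144.HXFlat *ᵥ w = 0) (hw' : w ∉ rowSpace BB.bb144.HZFlat) :
    12 ≤ hammingNorm w := by
  rw [← HX_eq_flat] at hw
  rw [← HZ_eq_flat] at hw'
  exact lowerZ4_of_blockBounds hblock w hw hw'

/-! ## The α′ adapter: a block's BZ-enumeration verdict gives its semantic bound -/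

/-- **α′ lane adapter**: block `b`'s Bool verdict `cert.bzZBlock bzAut4Data b = true` (assembled from the emitted
`bzZSys`/`bzZEnum`/`bzZBound` parts by `DistCert.bzZBlock_of_parts`) gives block `b`'s semantic bound. -/
theorem blockBound4_of_bzZBlock (b : Fin bzAut4Data.sideZ.blocks.length) (hb : cert.bzZBlock bzAut4Data b = true)
    (z : Fin cert.n → ZMod 2) (hz : rowMatrix cert.n cert.HX *ᵥ z = 0) (hz' : z ∉ rowSpace (rowMatrix cert.n cert.HZ))
    (hlab : ldMat cert.n bzAut4Data.LZ bzAut4Data.LX *ᵥ z ∈ Submodule.span (ZMod 2)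
      (Set.range fun l : Fin (bzAut4Data.sideZ.blocks[b]).W.length =>
        ofBits bzAut4Data.LZ.length (bzAut4Data.sideZ.blocks[b]).W[l])) :
    10 < hammingNorm z := by
  have hlen := len4_ok
  simp only [DistCert.bzZLen, bzLenOK, List.all_eq_true] at hlen
  have h := blockBound_of_bzBlockOK (wmax := cert.dZ - 1) (found := cert.sideZ.found) comm_flat foundZ_ok core4_ok b
    (by rw [List.all_eq_true]; exact hlen _ (List.getElem_mem b.2)) hb z hz hz' hlab
  exact h

/-- **α′ closer shape**: all four BZ-enumeration block verdicts ⇒ the flat bound `12 ≤ |w|` (standard axioms iff the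
verdict files are `decide +kernel`). -/
theorem twelve_le_flat_of_bzZBlocks4 (hblocks : ∀ b : ℕ, b < bzAut4Data.sideZ.blocks.length → cert.bzZBlock bzAut4Data b = true)
    (w : Fin (12 * 6 + 12 * 6) → ZMod 2) (hw : BB.bb144.HXFlat *ᵥ w = 0) (hw' : w ∉ rowSpace BB.bb144.HZFlat) :
    12 ≤ hammingNorm w :=
  twelve_le_flat_of_blockBounds4 (fun b => blockBound4_of_bzZBlock b (hblocks b b.2)) w hw hw'

end Summit.Ventures.QEC.Census.BB144
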